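import Summits.AtomisticToContinuum.FouriersLaw.Theorems.BondHeatUncertaintyBoundedResponseTotalBondComparisonB

/-!
# NODE 105 «TotalBondComparison» — part C of 3 (sequel of `…TotalBondComparisonA/B`): §4 statics, second-moment split, assembly of (TBC); §5 corollaries

Split for the 400-line cap by the landing lane (hand-2 g38) — 3-way cut at the lens's own markers (l.380 / l.544) approved by critic row 1446 (A); same namespace
`…Theorems.BoundedResponse.HeatSpreading`, opens and `variable {N : ℕ}` throughout; all FQNs unchanged; bodies verbatim.  0 sorry; standard axioms.
-/

noncomputable section

open MeasureTheory ProbabilityTheory Filter Topology Set Function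
open scoped NNReal ENNReal
open Literature.MathematicalPhysics.KineticTheory.HeatConduction
open Literature.MathematicalPhysics.KineticTheory OscillatorChain
open Literature.Probability.Process
open Summit.AtomisticToContinuum.FouriersLaw.Theorems.SubdiffusiveBondHeat


namespace Summit.AtomisticToContinuum.FouriersLaw.Theorems.BoundedResponse.HeatSpreading

open Summit.AtomisticToContinuum.FouriersLaw.Theorems.BoundedResponse.TransientContact
  (gibbsBondHeatVar gibbsBondCorr blockEnergyLeft blockEnergyLeftVar ExtensiveBlockEnergyVariance)
open Summit.AtomisticToContinuum.FouriersLaw.Theorems.BoundedResponse.ParityFloor (extensiveBlockEnergyVariance_holds)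
open Summit.AtomisticToContinuum.FouriersLaw.Theses.BondHeatUncertainty (BoundedResponse SubdiffusiveBondHeat)

variable {N : ℕ}

/-! ## §4 Statics of the spread, the abstract second-moment split, and the assembly of (TBC) -/

section Statics

/-- **Square-integral of a sum of centred differences** (abstract, any probability space): for `X, Y_i ∈ L²`
with `Var X, Var Y_i ≤ K`, the centred sum `F = ∑_{i ∈ s} [c_i]((X − EX) − (Y_i − EY_i))` has
`∫ F² ≤ |s|·|s|·4K` (Cauchy–Schwarz over `s`, `(a − b)² ≤ 2a² + 2b²`, `∫(X − EX)² = Var X`). [folklore] -/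
theorem integral_sq_sum_ite_centred_sub_le {Ω : Type*} [MeasurableSpace Ω] {μ : Measure Ω}
    [IsProbabilityMeasure μ] {ι : Type*} (s : Finset ι) (c : ι → Prop) [DecidablePred c] {X : Ω → ℝ}
    {Y : ι → Ω → ℝ} (hX : MemLp X 2 μ) (hY : ∀ i ∈ s, c i → MemLp (Y i) 2 μ) {K : ℝ}
    (hKX : variance X μ ≤ K) (hKY : ∀ i ∈ s, c i → variance (Y i) μ ≤ K) :
    Integrable (fun ω => (∑ i ∈ s,
        if c i then (X ω - ∫ ω', X ω' ∂μ) - (Y i ω - ∫ ω', Y i ω' ∂μ) else 0) ^ 2) μ ∧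
      ∫ ω, (∑ i ∈ s, if c i then (X ω - ∫ ω', X ω' ∂μ) - (Y i ω - ∫ ω', Y i ω' ∂μ) else 0) ^ 2 ∂μ ≤
        (s.card : ℝ) * (s.card * (4 * K)) := by
  have hK : 0 ≤ K := (variance_nonneg X μ).trans hKX
  have hXc : Integrable (fun ω => (X ω - ∫ ω', X ω' ∂μ) ^ 2) μ := (hX.sub (memLp_const _)).integrable_sq
  have hYc : ∀ i ∈ s, c i → Integrable (fun ω => (Y i ω - ∫ ω', Y i ω' ∂μ) ^ 2) μ :=
    fun i hi hc => ((hY i hi hc).sub (memLp_const _)).integrable_sq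
  -- the summands and the sum are in `L²`
  have hg : ∀ i ∈ s, MemLp (fun ω =>
      if c i then (X ω - ∫ ω', X ω' ∂μ) - (Y i ω - ∫ ω', Y i ω' ∂μ) else 0) 2 μ := by
    intro i hi
    by_cases hc : c i
    · simp only [hc, if_true]
      exact (hX.sub (memLp_const _)).sub ((hY i hi hc).sub (memLp_const _))
    · simp only [hc, if_false]
      exact memLp_const 0
  have hF : MemLp (fun ω => ∑ i ∈ s,
      if c i then (X ω - ∫ ω', X ω' ∂μ) - (Y i ω - ∫ ω', Y i ω' ∂μ) else 0) 2 μ :=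
    memLp_finsetSum s hg
  refine ⟨hF.integrable_sq, ?_⟩
  -- pointwise: Cauchy–Schwarz over `s` and `(a − b)² ≤ 2a² + 2b²`
  set h : ι → Ω → ℝ := fun i ω =>
    if c i then 2 * (X ω - ∫ ω', X ω' ∂μ) ^ 2 + 2 * (Y i ω - ∫ ω', Y i ω' ∂μ) ^ 2 else 0 with hh
  have hpt : ∀ ω, (∑ i ∈ s, if c i then (X ω - ∫ ω', X ω' ∂μ) - (Y i ω - ∫ ω', Y i ω' ∂μ) else 0) ^ 2 ≤
      (s.card : ℝ) * ∑ i ∈ s, h i ω := by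
    intro ω
    refine sq_sum_le_card_mul_sum_sq.trans ?_
    refine mul_le_mul_of_nonneg_left (Finset.sum_le_sum fun i _ => ?_) (Nat.cast_nonneg _)
    simp only [hh]
    split_ifs with hc
    · nlinarith [sq_nonneg ((X ω - ∫ ω', X ω' ∂μ) + (Y i ω - ∫ ω', Y i ω' ∂μ))]
    · simp
  have hhi : ∀ i ∈ s, Integrable (h i) μ := by
    intro i hi
    by_cases hc : c i
    · simp only [hh, hc, if_true]
      exact (hXc.const_mul 2).add ((hYc i hi hc).const_mul 2)
    · simp only [hh, hc, if_false]
      exact integrable_const 0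
  have hhint : ∀ i ∈ s, ∫ ω, h i ω ∂μ ≤ 4 * K := by
    intro i hi
    by_cases hc : c i
    · have h1 : ∫ ω, h i ω ∂μ = 2 * variance X μ + 2 * variance (Y i) μ := by
        simp only [hh, hc, if_true]
        rw [integral_add (hXc.const_mul 2) ((hYc i hi hc).const_mul 2), integral_const_mul, integral_const_mul,
          variance_eq_integral hX.aestronglyMeasurable.aemeasurable,
          variance_eq_integral (hY i hi hc).aestronglyMeasurable.aemeasurable]
      rw [h1]
      linarith [hKY i hi hc]
    · simp only [hh, hc, if_false, integral_zero]
      linarith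
  calc ∫ ω, (∑ i ∈ s, if c i then (X ω - ∫ ω', X ω' ∂μ) - (Y i ω - ∫ ω', Y i ω' ∂μ) else 0) ^ 2 ∂μ
      ≤ ∫ ω, (s.card : ℝ) * ∑ i ∈ s, h i ω ∂μ :=
        integral_mono hF.integrable_sq ((integrable_finsetSum s hhi).const_mul _) hpt
    _ = (s.card : ℝ) * ∑ i ∈ s, ∫ ω, h i ω ∂μ := by rw [integral_const_mul, integral_finsetSum s hhi]
    _ ≤ (s.card : ℝ) * ∑ i ∈ s, 4 * K := by
        gcongr with i hi
        exact hhint i hi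
    _ = (s.card : ℝ) * (s.card * (4 * K)) := by rw [Finset.sum_const, nsmul_eq_mul]

/-- **The abstract second-moment split**: if `A = c·B + (G − H)` pointwise and `B², G², H² ∈ L¹`, then
`∫ A² ≤ 2c²∫B² + 4∫G² + 4∫H²` (`(x + y)² ≤ 2x² + 2y²` twice; no integrability of `A²` needed). [folklore] -/
theorem integral_sq_le_of_eq_mul_add_sub {Ω : Type*} [MeasurableSpace Ω] {ν : Measure Ω} {A B G H : Ω → ℝ}
    {c : ℝ} (hpath : ∀ p, A p = c * B p + (G p - H p)) (hB : Integrable (fun p => B p ^ 2) ν)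
    (hG : Integrable (fun p => G p ^ 2) ν) (hH : Integrable (fun p => H p ^ 2) ν) :
    ∫ p, A p ^ 2 ∂ν ≤ 2 * c ^ 2 * ∫ p, B p ^ 2 ∂ν + 4 * ∫ p, G p ^ 2 ∂ν + 4 * ∫ p, H p ^ 2 ∂ν := by
  have hpt : ∀ p, A p ^ 2 ≤ 2 * c ^ 2 * B p ^ 2 + 4 * G p ^ 2 + 4 * H p ^ 2 := fun p => by
    rw [hpath p]
    nlinarith [sq_nonneg (c * B p - (G p - H p)), sq_nonneg (G p + H p)]
  have hint : Integrable (fun p => 2 * c ^ 2 * B p ^ 2 + 4 * G p ^ 2 + 4 * H p ^ 2) ν :=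
    ((hB.const_mul _).add (hG.const_mul _)).add (hH.const_mul _)
  calc ∫ p, A p ^ 2 ∂ν ≤ ∫ p, (2 * c ^ 2 * B p ^ 2 + 4 * G p ^ 2 + 4 * H p ^ 2) ∂ν :=
        integral_mono_of_nonneg (ae_of_all _ fun p => sq_nonneg _) hint (ae_of_all _ hpt)
    _ = 2 * c ^ 2 * ∫ p, B p ^ 2 ∂ν + 4 * ∫ p, G p ^ 2 ∂ν + 4 * ∫ p, H p ^ 2 ∂ν := by
        have i1 : Integrable (fun p => 2 * c ^ 2 * B p ^ 2) ν := hB.const_mul _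
        have i2 : Integrable (fun p => 4 * G p ^ 2) ν := hG.const_mul _
        have i3 : Integrable (fun p => 4 * H p ^ 2) ν := hH.const_mul _
        have i12 : Integrable (fun p => 2 * c ^ 2 * B p ^ 2 + 4 * G p ^ 2) ν := i1.add i2
        rw [integral_add i12 i3, integral_add i1 i2, integral_const_mul, integral_const_mul, integral_const_mul]

/-- **The CENTRED left-energy spread** `F̃_b = ∑_{i : i+1<N} ((E_{≤b} − ⟨E_{≤b}⟩_T) − (E_{≤i} − ⟨E_{≤i}⟩_T))`
(Gibbs means at temperature `T`): differs from `leftSpread` by a constant, so it carries the same INCREMENTS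
along any path, and it is the version whose square-integral the static variances control. [formal bookkeeping] -/
def leftSpreadCentred (P : OscillatorChain) (T : ℝ) (N b : ℕ) (y : PhaseSpace N) : ℝ :=
  ∑ i : Fin N, if i.val + 1 < N then
    (blockEnergyLeft P N b y - ∫ y', blockEnergyLeft P N b y' ∂(P.gibbsMeasure N T)) -
      (blockEnergyLeft P N i.val y - ∫ y', blockEnergyLeft P N i.val y' ∂(P.gibbsMeasure N T)) else 0

/-- `F_b(y) − F_b(y') = F̃_b(y) − F̃_b(y')`: centring does not change increments. [formal bookkeeping] -/
theorem leftSpread_sub_eq (P : OscillatorChain) (T : ℝ) (N b : ℕ) (y y' : PhaseSpace N) :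
    leftSpread P N b y - leftSpread P N b y' = leftSpreadCentred P T N b y - leftSpreadCentred P T N b y' := by
  simp only [leftSpread, leftSpreadCentred]
  rw [← Finset.sum_sub_distrib, ← Finset.sum_sub_distrib]
  refine Finset.sum_congr rfl fun i _ => ?_
  split_ifs <;> ring

/-- **The static cost of the spread**: under (W) (`ExtensiveBlockEnergyVariance`, PROVED:
`ParityFloor.extensiveBlockEnergyVariance_holds`) with constant `C_W`, the centred spread has
`F̃_b ∈ L²(μ_T)` and `∫ F̃_b² dμ_T ≤ 4·C_W·N³` (`N` summands, each a difference of two centred block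
energies of variance `≤ C_W N`). [folklore] -/
theorem pinnedChain_integrable_sq_leftSpreadCentred_and_le {ω₂ lam β γ T : ℝ} (hω : 0 < ω₂) (hl : 0 < lam)
    (hβ : 0 < β) (hT : 0 < T) {C_W : ℝ}
    (hW : ∀ N b : ℕ, b + 1 < N →
      MemLp (blockEnergyLeft (pinnedChain ω₂ lam β γ) N b) 2 ((pinnedChain ω₂ lam β γ).gibbsMeasure N T) ∧
        MemLp (TransientContact.blockEnergyRight (pinnedChain ω₂ lam β γ) N b) 2
          ((pinnedChain ω₂ lam β γ).gibbsMeasure N T) ∧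
        blockEnergyLeftVar (pinnedChain ω₂ lam β γ) T N b ≤ C_W * N ∧
        TransientContact.blockEnergyRightVar (pinnedChain ω₂ lam β γ) T N b ≤ C_W * N)
    {N b : ℕ} (hb : b + 1 < N) :
    Integrable (fun y => leftSpreadCentred (pinnedChain ω₂ lam β γ) T N b y ^ 2)
        ((pinnedChain ω₂ lam β γ).gibbsMeasure N T) ∧
      ∫ y, leftSpreadCentred (pinnedChain ω₂ lam β γ) T N b y ^ 2 ∂((pinnedChain ω₂ lam β γ).gibbsMeasure N T) ≤
        4 * C_W * (N : ℝ) ^ 3 := by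
  haveI := pinnedChain_isProbabilityMeasure_gibbsMeasure hω hl.le hβ.le γ N hT
  have h := integral_sq_sum_ite_centred_sub_le (μ := (pinnedChain ω₂ lam β γ).gibbsMeasure N T)
    (Finset.univ : Finset (Fin N)) (fun i : Fin N => i.val + 1 < N)
    (X := blockEnergyLeft (pinnedChain ω₂ lam β γ) N b) (Y := fun i : Fin N => blockEnergyLeft (pinnedChain ω₂ lam β γ) N i.val)
    (hW N b hb).1 (fun i _ hi => (hW N i.val hi).1) (K := C_W * N) (hW N b hb).2.2.1
    (fun i _ hi => (hW N i.val hi).2.2.1)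
  rw [Finset.card_univ, Fintype.card_fin] at h
  refine ⟨h.1, h.2.trans (le_of_eq ?_)⟩
  ring

end Statics

section Assembly

/-- **(TBC) PROVED — `TotalBondComparison`**: for the pinned anharmonic chain (`ω₂, lam, β, γ > 0`), `T > 0`,
there is `C` (`= 32·C_W`, `C_W` the constant of the PROVED static input (W) `ExtensiveBlockEnergyVariance`) with,
for every `N`, every bond `b` (`b + 1 < N`) and every `t ≥ 0`,
`V_N(t) ≤ 2(N−1)²·V_N(b,t) + C·N³`.
Proof: along the stationary constructed flow `z_s = Φ_s(x, B)` started from `μ_T` (kernel Gibbs invariance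
`pinnedChain_gibbsMeasure_bind_transitionKernel`), the TOTAL-HEAT IDENTITY `∫₀ᵗ J = (N−1)∫₀ᵗ j_b + F̃_b(z_t) − F̃_b(x)`
(`pinnedChain_totalHeat_eq`, path by path: interior site-energy balances telescope, `j_{N−1} ≡ 0`); square and
split `∫A² ≤ 2(N−1)²∫B² + 4∫F̃_b(z_t)² + 4∫F̃_b(x)²`; the second-moment dictionaries
`V_N(t) = E[(∫₀ᵗJ)²]` (`heatSpread_eq_integral_sq`), `V_N(b,t) = E[(∫₀ᵗ j_b)²]`
(`pinnedChain_integral_sq_intervalIntegral_of_invariant`), the one-time law `E[F̃(z_t)²] = E[F̃(x)²] = ∫F̃² dμ_T`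
(`pinnedChain_integrable_sq_solMap_of_invariant`) and the static cost `∫F̃_b² dμ_T ≤ 4C_W N³`.
Bookkeeping over [folklore] ingredients; 0 sorry. -/
theorem totalBondComparison_holds : TotalBondComparison := by
  intro ω₂ lam β γ hω hl hβ hγ T hT
  obtain ⟨C_W, hW⟩ := extensiveBlockEnergyVariance_holds ω₂ lam β γ hω hl hβ hγ T hT
  refine ⟨32 * C_W, fun N b hb t ht => ?_⟩
  have hN : 0 < N := by omega
  have hbN : b < N := by omega
  haveI := pinnedChain_isProbabilityMeasure_gibbsMeasure hω hl.le hβ.le γ N hT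
  have hinv : ∀ s : ℝ≥0, ((pinnedChain ω₂ lam β γ).gibbsMeasure N T).bind
      ((pinnedChain ω₂ lam β γ).transitionKernel N T T s) = (pinnedChain ω₂ lam β γ).gibbsMeasure N T :=
    fun s => pinnedChain_gibbsMeasure_bind_transitionKernel hω hl.le hβ.le hγ.le hN hT s
  -- the bond heat: `B² ∈ L¹` and `E[B²] = V_N(b,t)`
  have hjm : Measurable ((pinnedChain ω₂ lam β γ).bondCurrent N ⟨b, hbN⟩) :=
    (pinnedChain_continuous_bondCurrent ω₂ lam β γ N _).measurable
  have hj2 : Integrable (fun y => (pinnedChain ω₂ lam β γ).bondCurrent N ⟨b, hbN⟩ y ^ 2)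
      ((pinnedChain ω₂ lam β γ).gibbsMeasure N T) :=
    SubdiffusiveBondHeat.pinnedChain_integrable_sq_bondCurrent hω hl.le hβ.le γ N hT _
  have hB2 : Integrable (fun p : PhaseSpace N × WienerPair => (∫ s in (0 : ℝ)..t,
      (pinnedChain ω₂ lam β γ).bondCurrent N ⟨b, hbN⟩
        ((pinnedChain ω₂ lam β γ).solMap N T T s p.1 (pairPath p.2))) ^ 2)
      (((pinnedChain ω₂ lam β γ).gibbsMeasure N T).prod wienerPair) := by
    have h := pinnedChain_integrable_intervalIntegral_mul_of_invariant hω hl.le hβ.le hγ.le N T T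
      ((pinnedChain ω₂ lam β γ).gibbsMeasure N T) hinv hjm hjm hj2 hj2 ht
    simpa only [sq] using h
  have hV : ∫ p, (∫ s in (0 : ℝ)..t, (pinnedChain ω₂ lam β γ).bondCurrent N ⟨b, hbN⟩
      ((pinnedChain ω₂ lam β γ).solMap N T T s p.1 (pairPath p.2))) ^ 2
        ∂(((pinnedChain ω₂ lam β γ).gibbsMeasure N T).prod wienerPair) =
      gibbsBondHeatVar (pinnedChain ω₂ lam β γ) T N b t := by
    rw [pinnedChain_integral_sq_intervalIntegral_of_invariant hω hl.le hβ.le hγ.le N T T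
      ((pinnedChain ω₂ lam β γ).gibbsMeasure N T) hinv hjm hj2 ht]
    simp only [gibbsBondHeatVar, gibbsBondCorr, dif_pos hbN]
  -- the centred spread: static cost and the one-time law at times `t` and `0`
  obtain ⟨hF2, hF_le⟩ := pinnedChain_integrable_sq_leftSpreadCentred_and_le (γ := γ) hω hl hβ hT hW hb
  have hFz := pinnedChain_integrable_sq_solMap_of_invariant hω hl.le hβ.le hγ.le N T T
    ((pinnedChain ω₂ lam β γ).gibbsMeasure N T) hinv hF2 t
  have hFx := pinnedChain_integrable_sq_solMap_of_invariant hω hl.le hβ.le hγ.le N T T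
    ((pinnedChain ω₂ lam β γ).gibbsMeasure N T) hinv hF2 0
  have h0 : ∀ (y : PhaseSpace N) (w' : WienerPair), (pinnedChain ω₂ lam β γ).solMap N T T 0 y w' = y :=
    fun y w' => pinnedChain_solMap_of_nonpos N T T y w' le_rfl
  simp only [h0] at hFx
  -- the total-heat identity along every path, squared and integrated
  have hpath : ∀ p : PhaseSpace N × WienerPair,
      (∫ s in (0 : ℝ)..t, ∑ i : Fin N, (pinnedChain ω₂ lam β γ).bondCurrent N i
          ((pinnedChain ω₂ lam β γ).solMap N T T s p.1 (pairPath p.2))) =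
        ((N : ℝ) - 1) * (∫ s in (0 : ℝ)..t, (pinnedChain ω₂ lam β γ).bondCurrent N ⟨b, hbN⟩
            ((pinnedChain ω₂ lam β γ).solMap N T T s p.1 (pairPath p.2))) +
          (leftSpreadCentred (pinnedChain ω₂ lam β γ) T N b ((pinnedChain ω₂ lam β γ).solMap N T T t p.1 (pairPath p.2)) -
            leftSpreadCentred (pinnedChain ω₂ lam β γ) T N b p.1) := by
    intro p
    rw [pinnedChain_totalHeat_eq hω hl.le hβ.le hγ.le T T p.1 (pairPath p.2) ht hb, leftSpread_sub_eq _ T]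
  have hsplit := integral_sq_le_of_eq_mul_add_sub hpath hB2 hFz.1 hFx.1
  rw [hV, hFz.2, hFx.2] at hsplit
  rw [heatSpread_eq_integral_sq hω hl hβ hγ hT hN ht]
  linarith [hsplit, hF_le]

end Assembly


/-! ## §5 Corollaries through the NODE-104 doors: the (S) branch now decides `11071 ⟺ (TCᶜ_3)` -/

section Corollaries

/-- ★ **(S) ⟹ (HSᴾ_3)**: the subdiffusive single-bond heat bound (route crux `SubdiffusiveBondHeat`, item 9120) gives NORMAL heat
spreading at the Thouless time, `V_N(cN²) ≤ C·N³` — the NODE-104 seam `heatSpreadPoint_three_of_subdiffusive_comparison` with its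
(TBC) hypothesis discharged by `totalBondComparison_holds`. [folklore] -/
theorem heatSpreadPoint_three_of_subdiffusiveBondHeat (hS : SubdiffusiveBondHeat) : HeatSpreadPoint 3 :=
  heatSpreadPoint_three_of_subdiffusive_comparison hS totalBondComparison_holds

/-- ★ **(S) ∧ (TCᶜ_3) ⟹ 11071**: the (S) branch plus the Green–Kubo tail ceiling `Tr_N(cN²) ≤ C·N³` give `BoundedResponse`
(NODE-104 door `boundedResponse_of_subdiffusive_comparison_gkTailCeiling`, (TBC) discharged). [folklore] -/
theorem boundedResponse_of_subdiffusiveBondHeat_gkTailCeiling_three (hS : SubdiffusiveBondHeat) (hC : GKTailCeiling 3) :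
    BoundedResponse :=
  boundedResponse_of_subdiffusive_comparison_gkTailCeiling hS totalBondComparison_holds hC

/-- ★ **(S) ⟹ (11071 ⟺ (TCᶜ_3))**: given the (S) branch, the blocker `BoundedResponse` IS the Green–Kubo tail ceiling
(`⟹` unconditional: `gkTailCeiling_three_of_boundedResponse`). [folklore] -/
theorem boundedResponse_iff_gkTailCeiling_three_of_subdiffusiveBondHeat (hS : SubdiffusiveBondHeat) :
    BoundedResponse ↔ GKTailCeiling 3 :=
  boundedResponse_iff_gkTailCeiling_three_of_subdiffusive_comparison hS totalBondComparison_holds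

end Corollaries

end Summit.AtomisticToContinuum.FouriersLaw.Theorems.BoundedResponse.HeatSpreading

end
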